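import Literature.Geometry.Kaehler.HolomorphicChainRectifiable
import Literature.Geometry.Kaehler.AnalyticSetLinearEmbedding
import Literature.Geometry.Kaehler.AnalyticSetProperIntersection
import Literature.Geometry.Kaehler.AnalyticSetProduct
import Literature.Geometry.Kaehler.AnalyticSetHausdorffNull
import Literature.Geometry.Kaehler.AnalyticSetSingularLocusCodim
import Literature.Geometry.Kaehler.AnalyticSetBranchLocus
import Literature.Analysis.Calculus.SardProofs
import Literature.Analysis.Complex.OsgoodProofs
import Mathlib.Analysis.Normed.Lp.MeasurableSpace
import HarnessLib

/-!
# Slices of an analytic subset of `E₁ ⊞ E₂` by the fibres of the second projection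

Layer `Literature/Geometry/Kaehler`, namespace `Literature.Geometry.Kaehler`; lane `lit-hodgefound`,
seat p07, programme «THE ANALYTIC CLASSES OF A COMPLEX TORUS FORM A RING», file 3 (files 1–2:
`ComplexTorusAnalyticClassesCupProductReduction.lean`, `HolomorphicChainSheetCoarea.lean`). For an
analytic subset `A` of the Euclidean product `E = E₁ ⊞ E₂ = WithLp 2 (E₁ × E₂)` of finite-dimensional
complex normed spaces and `t ∈ E₂`, the **slice** `A_t = {x ∈ E₁ : (x, t) ∈ A}` is the preimage of `A`
under the affine holomorphic embedding `x ↦ (x, t)`; this file collects the deterministic (pointwise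
in `t`) facts about slices used by the fibre formula `∫_A pr₁^*γ ∧ pr₂^*dvol = ∫ (∫_{A_t} γ) dt`:

* §1 `isAnalyticSet_slice` — slices of analytic sets are analytic ([Chirka1989, §2.1 item 3:
  preimages under holomorphic maps]).
* §2 **regular points of slices at non-critical points** ([Chirka1989, §2.3; A2.2 implicit function
  theorem]): if `A` is cut out near `z = (x, t)` by a holomorphic `g : E → ℂᶜ` with `dg(z)` onto AND
  `∂ₓ g(z) = dg(z)|_{E₁ × 0}` onto — equivalently the tangent space `T_z A = ker dg(z)` projects ONTO
  `E₂` (`surjective_fderiv_comp_sliceEmb_iff`), a condition independent of the defining map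
  (`forall_exists_mem_ker_of_localEquations`, kernel comparison [Chirka1989, §2.3]) — then `x` is a
  regular point of the slice `A_t` of the same codimension `c` (`isRegPt_slice_of_localEquation`,
  `isRegPt_slice_of_nonCritical`): `dim_x A_t = dim_z A - dim E₂`.
* §3 `SCV.IsRegPt.hausdorffMeasure_inter_pos` — **near a regular point of dimension `r` an analytic
  set has positive `𝓗^{2r}`-measure** (the straightened parametrisation has a Lipschitz inverse onto a
  ball of `ℂʳ`; [Chirka1989, §2.3 and §3.7]).
* §4 `add_le_finrank_of_isRegPt_slice` — **lower bound for the dimension of slices**: for `A` of pure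
  dimension `D`, every regular point of `A_t` has dimension `≥ D - dim E₂` ([Chirka1989, §3.5
  Prop. 2, p. 36]: `codim_a (A ∩ L) ≤ codim A + codim L`, applied with `L = E₁ × {t}` through the
  tree's `HasPureDim.le_dim_of_isRegularPointOfCodim_inter` and the linear embedding dictionary of
  `AnalyticSetLinearEmbedding.lean`).

* §5 `measure_image_snd_critical_eq_zero` — **Sard for the second projection on the regular part**:
  the critical regular points of `A` (those at which the tangent space does not project onto `E₂`)
  have a `pr₂`-image of Haar measure zero; in each straightened chart `Ψ₀` of [Chirka1989, §2.3]
  they are critical points of the `C^∞` map `pr₂ ∘ Ψ₀` ([MilnorTDV1965, §3]; the tree's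
  `Literature.Analysis.Calculus.measure_image_setOf_not_surjective_fderiv_eq_zero`), and countably many
  charts cover `reg A` (Lindelöf).
* §6 `ae_hausdorffMeasure_slice_eq_zero_of_dim_le` — **almost every slice of an analytic set of
  dimension `≤ m` is `𝓗^{2k}`-null when `m < k + dim E₂`** (the analytic form of the slicing
  inequality [Federer1969, 2.10.25 / 3.2.22]): induction on `m` through the singular locus
  (Cartan–Whitney, the tree's `isAnalyticSet_singularLocus_holds`; `dim sng A < dim A`,
  [Chirka1989, §2.3]), the regular strata being handled by §5 and §2.
* §7 `hasPureDim_slice_of_notMem_of_null`, **`ae_hasPureDim_slice`** — **for `A` of pure dimension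
  `D = q + dim E₂`, almost every slice `A_t` is empty or of pure dimension `q`**, and off a null set of
  `t` no regular point of `A` over `t` is critical and `(sng A)_t` is `𝓗^{2q}`-null.

Theorems only; no definitions, no named facts.

## References

* [Chirka1989] E. M. Chirka, *Complex Analytic Sets*, Kluwer 1989, §2.1, §2.3 (regular points, p. 29;
  density of `reg A`), §3.5 Prop. 2 (p. 36), §3.7 Cor. (p. 39), §4.5, A2.2.
* [Federer1969] H. Federer, *Geometric Measure Theory*, Springer 1969, 2.10.25, 3.2.22 (slicing).
* [MilnorTDV1965] J. Milnor, *Topology from the Differentiable Viewpoint*, 1965, §3 (Sard's theorem).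
-/

noncomputable section

open scoped Manifold Topology ENNReal NNReal
open Set Filter MeasureTheory MeasureTheory.Measure Metric Module Function WithLp

universe u

namespace Literature.Geometry.Kaehler

variable {E₁ : Type u} [NormedAddCommGroup E₁] [NormedSpace ℂ E₁] [FiniteDimensional ℂ E₁]
  {E₂ : Type u} [NormedAddCommGroup E₂] [NormedSpace ℂ E₂] [FiniteDimensional ℂ E₂]

/-! ### §1 The slice embedding and slices of analytic sets -/

omit [FiniteDimensional ℂ E₁] [FiniteDimensional ℂ E₂] in
/-- The slice embedding `x ↦ (x, t)` has derivative `h ↦ (h, 0)` (it is affine; [Chirka1989, §2.1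
item 3]: linear changes of coordinates and holomorphic maps). [cite: Chirka1989, §2.1 (item 3), p. 17] -/
theorem hasFDerivAt_sliceEmb (t : E₂) (x : E₁) :
    HasFDerivAt (fun x' : E₁ ↦ (toLp 2 (x', t) : WithLp 2 (E₁ × E₂)))
      ((((WithLp.prodContinuousLinearEquiv 2 ℂ E₁ E₂).symm : E₁ × E₂ →L[ℂ] WithLp 2 (E₁ × E₂)).comp
        (ContinuousLinearMap.inl ℂ E₁ E₂))) x :=
  ((WithLp.prodContinuousLinearEquiv 2 ℂ E₁ E₂).symm : E₁ × E₂ →L[ℂ] WithLp 2 (E₁ × E₂)).hasFDerivAt.comp x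
    (hasFDerivAt_prodMk_left x t)

omit [FiniteDimensional ℂ E₁] [FiniteDimensional ℂ E₂] in
/-- The slice embedding `x ↦ (x, t)` is holomorphic. [cite: Chirka1989, §2.1 (item 3), p. 17] -/
theorem differentiable_sliceEmb (t : E₂) :
    Differentiable ℂ (fun x' : E₁ ↦ (toLp 2 (x', t) : WithLp 2 (E₁ × E₂))) := fun x ↦
  (hasFDerivAt_sliceEmb t x).differentiableAt

omit [FiniteDimensional ℂ E₁] [FiniteDimensional ℂ E₂] in
/-- **Slices of analytic sets are analytic**: `A_t = {x : (x, t) ∈ A}` is an analytic subset of `E₁`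
(preimage of `A` under the holomorphic map `x ↦ (x, t)`). [cite: Chirka1989, §2.1 (item 3), p. 17] -/
theorem isAnalyticSet_slice {A : Set (WithLp 2 (E₁ × E₂))}
    (hA : IsAnalyticSet 𝓘(ℂ, WithLp 2 (E₁ × E₂)) A) (t : E₂) :
    IsAnalyticSet 𝓘(ℂ, E₁) {x : E₁ | toLp 2 (x, t) ∈ A} :=
  hA.preimage (mdifferentiable_iff_differentiable.2 (differentiable_sliceEmb t))

omit [FiniteDimensional ℂ E₁] [FiniteDimensional ℂ E₂] in
/-- Chain rule along the slice embedding: the partial derivative `∂ₓ g(x, t)` is `dg(x, t) ∘ (h ↦ (h, 0))`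
([Chirka1989, A2.2]: the Jacobian blocks of the implicit function theorem).
[cite: Chirka1989, A2.2 (implicit function theorem), p. 305] -/
theorem fderiv_comp_sliceEmb {F : Type*} [NormedAddCommGroup F] [NormedSpace ℂ F]
    {g : WithLp 2 (E₁ × E₂) → F} {t : E₂} {x : E₁} (hg : DifferentiableAt ℂ g (toLp 2 (x, t))) :
    fderiv ℂ (fun x' : E₁ ↦ g (toLp 2 (x', t))) x =
      (fderiv ℂ g (toLp 2 (x, t))).comp
        ((((WithLp.prodContinuousLinearEquiv 2 ℂ E₁ E₂).symm : E₁ × E₂ →L[ℂ] WithLp 2 (E₁ × E₂)).comp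
          (ContinuousLinearMap.inl ℂ E₁ E₂))) :=
  (hg.hasFDerivAt.comp x (hasFDerivAt_sliceEmb t x)).fderiv

/-! ### §2 Regular points of slices -/

omit [FiniteDimensional ℂ E₁] [FiniteDimensional ℂ E₂] in
/-- **A local equation with surjective partial derivative cuts out a regular point of the slice.**
If `A ∩ U = {g = 0} ∩ U` near `(x, t)` with `g` holomorphic on the open `U` and
`∂ₓ g(x, t) : E₁ → ℂᶜ` onto, then `x` is a regular point of codimension `c` of `A_t`
(equations `g(·, t)`). [cite: Chirka1989, §2.3 (regular points), p. 29] -/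
theorem isRegPt_slice_of_localEquation {A U : Set (WithLp 2 (E₁ × E₂))} {t : E₂} {x : E₁} {c : ℕ}
    {g : WithLp 2 (E₁ × E₂) → (Fin c → ℂ)} (hU : IsOpen U) (hxU : toLp 2 (x, t) ∈ U)
    (hg : DifferentiableOn ℂ g U) (hAU : A ∩ U = U ∩ g ⁻¹' {0})
    (hsurj : Surjective (fderiv ℂ (fun x' : E₁ ↦ g (toLp 2 (x', t))) x)) :
    SCV.IsRegPt {x' : E₁ | toLp 2 (x', t) ∈ A} c x := by
  refine ⟨{x' : E₁ | toLp 2 (x', t) ∈ U}, hU.preimage (differentiable_sliceEmb t).continuous, hxU,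
    fun x' ↦ g (toLp 2 (x', t)),
    hg.comp (differentiable_sliceEmb t).differentiableOn (fun x' hx' ↦ hx'), ?_, hsurj⟩
  ext x'
  have h := Set.ext_iff.1 hAU (toLp 2 (x', t))
  simpa only [mem_inter_iff, mem_setOf_eq, mem_preimage] using h

omit [FiniteDimensional ℂ E₁] [FiniteDimensional ℂ E₂] in
/-- **Non-criticality as a property of the tangent space.** For a linear map `L : E₁ ⊞ E₂ → F` which
is onto, the restriction `L|_{E₁ × 0}` is onto iff `ker L` projects onto `E₂` — the invertibility of the
partial Jacobian `∂f/∂z″` in the implicit function theorem [Chirka1989, A2.2] read on the tangent space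
`ker L`. [cite: Chirka1989, A2.2 (implicit function theorem), p. 305] -/
theorem surjective_comp_sliceEmb_iff {F : Type*} [AddCommGroup F] [Module ℂ F]
    (L : WithLp 2 (E₁ × E₂) →ₗ[ℂ] F) (hL : Surjective L) :
    Surjective (fun h : E₁ ↦ L (toLp 2 (h, (0 : E₂)))) ↔
      ∀ v : E₂, ∃ u : WithLp 2 (E₁ × E₂), L u = 0 ∧ (ofLp u).2 = v := by
  constructor
  · intro h v
    obtain ⟨k, hk⟩ := h (L (toLp 2 ((0 : E₁), v)))
    refine ⟨toLp 2 ((0 : E₁), v) - toLp 2 (k, (0 : E₂)), ?_, ?_⟩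
    · simp only [map_sub]
      rw [← hk, sub_self]
    · simp
  · intro h y
    obtain ⟨w, rfl⟩ := hL y
    obtain ⟨u, hu0, hu2⟩ := h (ofLp w).2
    refine ⟨(ofLp (w - u)).1, ?_⟩
    have hwu : toLp 2 ((ofLp (w - u)).1, (0 : E₂)) = w - u := by
      have h2 : (ofLp (w - u)).2 = 0 := by
        rw [WithLp.ofLp_sub, Prod.snd_sub, hu2, sub_self]
      calc toLp 2 ((ofLp (w - u)).1, (0 : E₂))
          = toLp 2 ((ofLp (w - u)).1, (ofLp (w - u)).2) := by rw [h2]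
        _ = w - u := rfl
    simp only [hwu, map_sub, hu0, sub_zero]

/-- **The tangent space at a regular point does not depend on the local equation** (kernel comparison,
[Chirka1989, §2.3]): if `ker dg(z)` projects onto `E₂` for one local equation `g` of `A` at `z ∈ A`
(with `dg(z)` onto), it does so for every other local equation `g'` of `A` at `z`.
[cite: Chirka1989, §2.3 (regular points), p. 29] -/
theorem forall_exists_mem_ker_of_localEquations {A U U' : Set (WithLp 2 (E₁ × E₂))}
    {z : WithLp 2 (E₁ × E₂)} {c c' : ℕ} {g : WithLp 2 (E₁ × E₂) → (Fin c → ℂ)}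
    {g' : WithLp 2 (E₁ × E₂) → (Fin c' → ℂ)} (hzA : z ∈ A) (hU : IsOpen U) (hzU : z ∈ U)
    (hg : DifferentiableOn ℂ g U) (hAU : A ∩ U = U ∩ g ⁻¹' {0}) (hsurj : Surjective (fderiv ℂ g z))
    (hU' : IsOpen U') (hzU' : z ∈ U') (hg' : DifferentiableOn ℂ g' U')
    (hAU' : A ∩ U' = U' ∩ g' ⁻¹' {0})
    (hnc : ∀ v : E₂, ∃ u : WithLp 2 (E₁ × E₂), fderiv ℂ g z u = 0 ∧ (ofLp u).2 = v) :
    ∀ v : E₂, ∃ u : WithLp 2 (E₁ × E₂), fderiv ℂ g' z u = 0 ∧ (ofLp u).2 = v := by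
  have hgz : g z = 0 := by
    have : z ∈ U ∩ g ⁻¹' {0} := hAU ▸ ⟨hzA, hzU⟩
    exact this.2
  have hg'z : g' z = 0 := by
    have : z ∈ U' ∩ g' ⁻¹' {0} := hAU' ▸ ⟨hzA, hzU'⟩
    exact this.2
  have hker := SCV.ker_fderiv_le_ker_fderiv_of_forall_eq (F := g) (Gf := g') (W := U ∩ U')
    (hg.mono inter_subset_left) (hg'.mono inter_subset_right) (hU.inter hU') ⟨hzU, hzU'⟩ hsurj
    (fun y hy hgy ↦ by
      rw [hgz] at hgy
      have hyA : y ∈ A := by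
        have : y ∈ U ∩ g ⁻¹' {0} := ⟨hy.1, hgy⟩
        rw [← hAU] at this
        exact this.1
      have : y ∈ U' ∩ g' ⁻¹' {0} := hAU' ▸ ⟨hyA, hy.2⟩
      rw [hg'z]; exact this.2)
  intro v
  obtain ⟨u, hu0, hu2⟩ := hnc v
  exact ⟨u, LinearMap.mem_ker.1 (hker (LinearMap.mem_ker.2 hu0)), hu2⟩

/-- **At a non-critical regular point, every local equation of `A` has surjective partial derivative
along `E₁`.** [cite: Chirka1989, §2.3 (regular points), p. 29] -/
theorem surjective_fderiv_comp_sliceEmb_of_nonCritical {A U U' : Set (WithLp 2 (E₁ × E₂))} {t : E₂}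
    {x : E₁} {c c' : ℕ} {g : WithLp 2 (E₁ × E₂) → (Fin c → ℂ)} {g' : WithLp 2 (E₁ × E₂) → (Fin c' → ℂ)}
    (hzA : toLp 2 (x, t) ∈ A) (hU : IsOpen U) (hzU : toLp 2 (x, t) ∈ U) (hg : DifferentiableOn ℂ g U)
    (hAU : A ∩ U = U ∩ g ⁻¹' {0}) (hsurj : Surjective (fderiv ℂ g (toLp 2 (x, t))))
    (hnc : ∀ v : E₂, ∃ u : WithLp 2 (E₁ × E₂), fderiv ℂ g (toLp 2 (x, t)) u = 0 ∧ (ofLp u).2 = v)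
    (hU' : IsOpen U') (hzU' : toLp 2 (x, t) ∈ U') (hg' : DifferentiableOn ℂ g' U')
    (hAU' : A ∩ U' = U' ∩ g' ⁻¹' {0}) (hsurj' : Surjective (fderiv ℂ g' (toLp 2 (x, t)))) :
    Surjective (fderiv ℂ (fun x' : E₁ ↦ g' (toLp 2 (x', t))) x) := by
  have hnc' := forall_exists_mem_ker_of_localEquations hzA hU hzU hg hAU hsurj hU' hzU' hg' hAU' hnc
  rw [fderiv_comp_sliceEmb (hg'.differentiableAt (hU'.mem_nhds hzU'))]
  have h := (surjective_comp_sliceEmb_iff (fderiv ℂ g' (toLp 2 (x, t)) :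
    WithLp 2 (E₁ × E₂) →ₗ[ℂ] (Fin c' → ℂ)) hsurj').2 hnc'
  intro y
  obtain ⟨h', hh'⟩ := h y
  exact ⟨h', by simpa using hh'⟩

/-- **Non-critical regular points slice to regular points of the same codimension**: if `A` admits at
`(x, t) ∈ A` a local equation `g` (`dg` onto) whose tangent space `ker dg(x, t)` projects onto `E₂`,
then for EVERY local equation `g'` of `A` at `(x, t)` (of codimension `c'`), `x` is a regular point of
codimension `c'` of the slice `A_t` — `dim_x A_t = dim_{(x,t)} A - dim E₂`.
[cite: Chirka1989, §2.3 (regular points), p. 29; A2.2] -/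
theorem isRegPt_slice_of_nonCritical {A U U' : Set (WithLp 2 (E₁ × E₂))} {t : E₂}
    {x : E₁} {c c' : ℕ} {g : WithLp 2 (E₁ × E₂) → (Fin c → ℂ)} {g' : WithLp 2 (E₁ × E₂) → (Fin c' → ℂ)}
    (hzA : toLp 2 (x, t) ∈ A) (hU : IsOpen U) (hzU : toLp 2 (x, t) ∈ U) (hg : DifferentiableOn ℂ g U)
    (hAU : A ∩ U = U ∩ g ⁻¹' {0}) (hsurj : Surjective (fderiv ℂ g (toLp 2 (x, t))))
    (hnc : ∀ v : E₂, ∃ u : WithLp 2 (E₁ × E₂), fderiv ℂ g (toLp 2 (x, t)) u = 0 ∧ (ofLp u).2 = v)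
    (hU' : IsOpen U') (hzU' : toLp 2 (x, t) ∈ U') (hg' : DifferentiableOn ℂ g' U')
    (hAU' : A ∩ U' = U' ∩ g' ⁻¹' {0}) (hsurj' : Surjective (fderiv ℂ g' (toLp 2 (x, t)))) :
    SCV.IsRegPt {x' : E₁ | toLp 2 (x', t) ∈ A} c' x :=
  isRegPt_slice_of_localEquation hU' hzU' hg' hAU'
    (surjective_fderiv_comp_sliceEmb_of_nonCritical hzA hU hzU hg hAU hsurj hnc hU' hzU' hg' hAU' hsurj')

/-! ### §3 Positive measure near a regular point -/

section Pos

variable {V : Type*} [NormedAddCommGroup V] [NormedSpace ℂ V] [FiniteDimensional ℂ V]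
  [MeasurableSpace V] [BorelSpace V]

/-- **Near a regular point of dimension `r`, an analytic set has positive `𝓗^{2r}`-measure**: if
`x ∈ S` is a regular point of codimension `c` (`r = dim V - c`) then `𝓗^{2r}(S ∩ U) > 0` for every
neighbourhood `U` of `x` — the straightened parametrisation of [Chirka1989, §2.3] presents `S` near `x`
as a holomorphic image of a ball of `ℂʳ` with a LIPSCHITZ inverse (a linear projection), and Lipschitz
maps do not increase `𝓗^{2r}` by more than a constant factor. [cite: Chirka1989, §2.3, p. 29 and §3.7] -/
theorem SCV.IsRegPt.hausdorffMeasure_inter_pos {S : Set V} {c : ℕ} {x : V} (h : SCV.IsRegPt S c x)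
    (hx : x ∈ S) {U : Set V} (hU : U ∈ 𝓝 x) :
    0 < μH[((2 * (finrank ℂ V - c) : ℕ) : ℝ)] (S ∩ U) := by
  obtain ⟨N, g, K, π, ρ, Ψ₀, hNo, hxN, hNU, -, -, -, hrank, hρ, -, -, himage, hπ⟩ :=
    h.exists_straightParam hx hU
  haveI : FiniteDimensional ℝ K := FiniteDimensional.complexToReal K
  have hdim : finrank ℝ K = 2 * (finrank ℂ V - c) := by
    rw [finrank_real_of_complex]; omega
  -- the Lipschitz retraction `z ↦ π (z - x)` maps `S ∩ N` onto the ball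
  have hLip : LipschitzWith (‖(π : V →L[ℂ] K)‖₊ * (1 + 0)) (fun z : V ↦ π (z - x)) := by
    have h1 : LipschitzWith (1 + 0) (fun z : V ↦ z - x) :=
      LipschitzWith.id.sub (LipschitzWith.const x)
    exact π.lipschitz.comp h1
  have hball : (ball (0 : K) ρ) ⊆ (fun z : V ↦ π (z - x)) '' (S ∩ N) := by
    intro k hk
    have hk' : Ψ₀ k ∈ S ∩ N := himage ▸ mem_image_of_mem Ψ₀ hk
    exact ⟨Ψ₀ k, hk', hπ k hk⟩
  have hpos : 0 < μH[((2 * (finrank ℂ V - c) : ℕ) : ℝ)] (ball (0 : K) ρ) := by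
    rw [← hdim]
    exact isOpen_ball.measure_pos _ ⟨0, mem_ball_self hρ⟩
  have hle := (hLip.lipschitzOnWith (s := S ∩ N)).hausdorffMeasure_image_le
    (d := ((2 * (finrank ℂ V - c) : ℕ) : ℝ)) (by positivity)
  have h1 : 0 < μH[((2 * (finrank ℂ V - c) : ℕ) : ℝ)] (S ∩ N) := by
    by_contra h0
    rw [not_lt, nonpos_iff_eq_zero] at h0
    rw [h0, mul_zero] at hle
    exact (lt_irrefl _) ((hpos.trans_le (measure_mono hball)).trans_le hle)
  exact h1.trans_le (measure_mono (inter_subset_inter_right _ hNU))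

end Pos

/-! ### §4 Lower bound for the dimension of slices of a pure-dimensional set -/

omit [NormedSpace ℂ E₁] [FiniteDimensional ℂ E₁] [NormedSpace ℂ E₂] [FiniteDimensional ℂ E₂] in
/-- The slice `A_t` is the preimage of the translate `A - (0, t)` under the linear embedding
`x ↦ (x, 0)`. [folklore] -/
private theorem slice_eq_preimage_translate (A : Set (WithLp 2 (E₁ × E₂))) (t : E₂) :
    {x : E₁ | toLp 2 (x, t) ∈ A} =
      (fun x : E₁ ↦ (toLp 2 (x, (0 : E₂)) : WithLp 2 (E₁ × E₂))) ⁻¹'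
        ((Homeomorph.addRight (toLp 2 ((0 : E₁), t))) ⁻¹' A) := by
  ext x
  simp only [mem_setOf_eq, mem_preimage, Homeomorph.coe_addRight, ← WithLp.toLp_add, Prod.mk_add_mk,
    add_zero, zero_add]

/-- **Lower bound for the dimension of a slice** ([Chirka1989, §3.5 Prop. 2]:
`codim (A ∩ L) ≤ codim A + codim L` at every point): if `A ⊆ E₁ ⊞ E₂` has pure dimension `D` and `x` is
a regular point of codimension `c'` of the slice `A_t`, then `c' + D ≤ dim E₁ + dim E₂`, i.e.
`dim_x A_t ≥ D - dim E₂`. (The slice is `A ∩ (E₁ × {t})` read in `E₁` through the embedding `x ↦ (x, t)`,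
`AnalyticSetLinearEmbedding.lean`.) [cite: Chirka1989, §3.5 Prop. 2, p. 36] -/
theorem add_le_finrank_of_isRegPt_slice {A : Set (WithLp 2 (E₁ × E₂))} {D : ℕ}
    (hA : HasPureDim 𝓘(ℂ, WithLp 2 (E₁ × E₂)) A D) {t : E₂} {x : E₁} (hx : toLp 2 (x, t) ∈ A) {c' : ℕ}
    (h : SCV.IsRegPt {x' : E₁ | toLp 2 (x', t) ∈ A} c' x) :
    c' + D ≤ finrank ℂ E₁ + finrank ℂ E₂ := by
  -- translate `A` by `-(0, t)`
  set τ : WithLp 2 (E₁ × E₂) ≃ₜ WithLp 2 (E₁ × E₂) := Homeomorph.addRight (toLp 2 ((0 : E₁), t)) with hτ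
  have hτd : MDifferentiable 𝓘(ℂ, WithLp 2 (E₁ × E₂)) 𝓘(ℂ, WithLp 2 (E₁ × E₂)) τ :=
    mdifferentiable_iff_differentiable.2 (differentiable_id.add_const _)
  have hτd' : MDifferentiable 𝓘(ℂ, WithLp 2 (E₁ × E₂)) 𝓘(ℂ, WithLp 2 (E₁ × E₂)) τ.symm := by
    rw [hτ, Homeomorph.addRight_symm]
    exact mdifferentiable_iff_differentiable.2 (differentiable_id.add_const _)
  obtain ⟨c, hDc, hAc⟩ := hA
  have hA' : HasPureDim 𝓘(ℂ, WithLp 2 (E₁ × E₂)) (τ ⁻¹' A) D :=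
    ⟨c, hDc, hAc.preimage_homeomorph τ hτd hτd'⟩
  -- the linear embedding `j x = (x, 0)` with left inverse `P z = z₁`
  set j : E₁ →L[ℂ] WithLp 2 (E₁ × E₂) :=
    (((WithLp.prodContinuousLinearEquiv 2 ℂ E₁ E₂).symm : E₁ × E₂ →L[ℂ] WithLp 2 (E₁ × E₂)).comp
      (ContinuousLinearMap.inl ℂ E₁ E₂)) with hj
  set P : WithLp 2 (E₁ × E₂) →L[ℂ] E₁ :=
    (ContinuousLinearMap.fst ℂ E₁ E₂).comp
      (WithLp.prodContinuousLinearEquiv 2 ℂ E₁ E₂ : WithLp 2 (E₁ × E₂) →L[ℂ] E₁ × E₂) with hP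
  have hPj : ∀ k, P (j k) = k := fun k ↦ by simp [hj, hP]
  have hjap : ∀ k, j k = toLp 2 (k, (0 : E₂)) := fun k ↦ by simp [hj]
  have hslice : {x' : E₁ | toLp 2 (x', t) ∈ A} = j ⁻¹' (τ ⁻¹' A) := by
    rw [slice_eq_preimage_translate]
    ext k; simp only [mem_preimage, hjap, hτ]
  have himg : j '' {x' : E₁ | toLp 2 (x', t) ∈ A} = τ ⁻¹' A ∩ Set.range j := by
    rw [hslice, Set.image_preimage_eq_inter_range]
  -- `range j` has pure dimension `dim E₁`
  have hrange : HasPureDim 𝓘(ℂ, WithLp 2 (E₁ × E₂)) (Set.range j) (finrank ℂ E₁) := by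
    have := (hasPureDim_univ (I := 𝓘(ℂ, E₁)) (M := E₁)).image_of_leftInverse j P hPj
    rwa [image_univ] at this
  -- the regular point `j x` of `j(A_t) = τ⁻¹ A ∩ range j`
  have hxs : x ∈ {x' : E₁ | toLp 2 (x', t) ∈ A} := hx
  have hreg : IsRegularPointOfCodim 𝓘(ℂ, WithLp 2 (E₁ × E₂)) (τ ⁻¹' A ∩ Set.range j)
      (c' + (finrank ℂ (WithLp 2 (E₁ × E₂)) - finrank ℂ E₁)) (j x) := by
    rw [← himg]
    exact (SCV.isRegularPointOfCodim_iff_isRegPt.2 h).image_of_leftInverse j P hPj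
  have hmem : j x ∈ τ ⁻¹' A ∩ Set.range j := himg ▸ mem_image_of_mem j hxs
  have key := hA'.le_dim_of_isRegularPointOfCodim_inter hrange hmem hreg
  have hn : finrank ℂ (WithLp 2 (E₁ × E₂)) = finrank ℂ E₁ + finrank ℂ E₂ := by
    rw [(WithLp.linearEquiv 2 ℂ (E₁ × E₂)).finrank_eq, Module.finrank_prod]
  rw [hn] at key
  omega

/-! ### §5 Sard: the critical values of the second projection on the regular part are null -/

section Sard

variable [MeasurableSpace E₂] [BorelSpace E₂]

omit [MeasurableSpace E₂] [BorelSpace E₂] in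
/-- **In a straightened parametrisation, surjectivity of the differential of `pr₂ ∘ Ψ₀` gives a
non-critical point.** Let `N, g, K, π, ρ, Ψ₀` be the straightening data of `A` at a regular point
([Chirka1989, §2.3]: `A ∩ N = Ψ₀(B) = {g = 0} ∩ N`, `dg` onto on `N`). If at `k ∈ B` the real
differential of `k ↦ (Ψ₀ k)₂` is onto `E₂`, then `ker dg(Ψ₀ k) = im DΨ₀(k)` projects onto `E₂`.
[cite: Chirka1989, §2.3 (p. 29) and A2.2] -/
theorem forall_exists_mem_ker_of_surjective_fderiv_snd_straightParam {A N : Set (WithLp 2 (E₁ × E₂))}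
    {c : ℕ} {g : WithLp 2 (E₁ × E₂) → (Fin c → ℂ)} {K : Submodule ℂ (WithLp 2 (E₁ × E₂))}
    {π : WithLp 2 (E₁ × E₂) →L[ℂ] K} {ρ : ℝ} {Ψ₀ : K → WithLp 2 (E₁ × E₂)} {z₀ : WithLp 2 (E₁ × E₂)}
    (hNo : IsOpen N) (hg : DifferentiableOn ℂ g N) (hgA : ∀ z ∈ N, z ∈ A ↔ g z = 0)
    (hsurj : ∀ z ∈ N, Surjective (fderiv ℂ g z)) (hrank : finrank ℂ K + c = finrank ℂ (WithLp 2 (E₁ × E₂)))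
    (hΨ : DifferentiableOn ℂ Ψ₀ (ball 0 ρ)) (himage : Ψ₀ '' ball 0 ρ = A ∩ N)
    (hπ : ∀ k ∈ ball (0 : K) ρ, π (Ψ₀ k - z₀) = k) {k : K} (hk : k ∈ ball (0 : K) ρ)
    (hs : Surjective (fderiv ℝ (fun k : K ↦ (ofLp (Ψ₀ k)).2) k)) :
    ∀ v : E₂, ∃ u : WithLp 2 (E₁ × E₂), fderiv ℂ g (Ψ₀ k) u = 0 ∧ (ofLp u).2 = v := by
  have himN : ∀ k ∈ ball (0 : K) ρ, Ψ₀ k ∈ N := fun k hk ↦ (himage ▸ mem_image_of_mem Ψ₀ hk).2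
  have hg0 : ∀ k ∈ ball (0 : K) ρ, g (Ψ₀ k) = 0 := fun k hk ↦
    (hgA _ (himN k hk)).1 (himage ▸ mem_image_of_mem Ψ₀ hk).1
  obtain ⟨-, -, hrange⟩ := SCV.straightParam_fderiv hNo hg hsurj hrank hΨ himN hg0 hπ hk
  -- the real differential of `k ↦ (Ψ₀ k)₂`
  set P₂ : WithLp 2 (E₁ × E₂) →L[ℝ] E₂ := (ContinuousLinearMap.snd ℝ E₁ E₂).comp
    (WithLp.prodContinuousLinearEquiv 2 ℝ E₁ E₂ : WithLp 2 (E₁ × E₂) →L[ℝ] E₁ × E₂) with hP₂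
  have hd : HasFDerivAt (fun k : K ↦ (ofLp (Ψ₀ k)).2) (P₂.comp ((fderiv ℂ Ψ₀ k).restrictScalars ℝ)) k :=
    P₂.hasFDerivAt.comp k (((hΨ.differentiableAt (isOpen_ball.mem_nhds hk)).hasFDerivAt).restrictScalars ℝ)
  rw [hd.fderiv] at hs
  intro v
  obtain ⟨h, hh⟩ := hs v
  refine ⟨fderiv ℂ Ψ₀ k h, ?_, by simpa [hP₂] using hh⟩
  have hmem : fderiv ℂ Ψ₀ k h ∈ LinearMap.range (fderiv ℂ Ψ₀ k : K →ₗ[ℂ] WithLp 2 (E₁ × E₂)) :=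
    ⟨h, rfl⟩
  rw [hrange] at hmem
  exact LinearMap.mem_ker.1 hmem

open scoped ContDiff in
/-- **Sard's theorem for the second projection on the regular part of an analytic set**: the set of
CRITICAL regular points of `A ⊆ E₁ ⊞ E₂` — regular points `z` at which the tangent space `ker dg(z)`
(for no / for every local equation `g`) fails to project onto `E₂` — has a `pr₂`-image of Haar measure
zero in `E₂`. (In each straightened chart `Ψ₀ : B ⊆ ℂʳ → A` the critical points are the critical
points of the `C^∞` map `pr₂ ∘ Ψ₀`, [Sard1942], [MilnorTDV1965, §3]; countably many charts cover
`reg A`.) [cite: MilnorTDV1965, §3, Theorem p. 16] [cite: Chirka1989, §2.3, p. 29] -/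
theorem measure_image_snd_critical_eq_zero (μ : Measure E₂) [μ.IsAddHaarMeasure]
    (A : Set (WithLp 2 (E₁ × E₂))) :
    μ ((fun z : WithLp 2 (E₁ × E₂) ↦ (ofLp z).2) '' {z ∈ A | (∃ c, SCV.IsRegPt A c z) ∧
      ¬ ∃ (U : Set (WithLp 2 (E₁ × E₂))) (c : ℕ) (g : WithLp 2 (E₁ × E₂) → (Fin c → ℂ)),
        IsOpen U ∧ z ∈ U ∧ DifferentiableOn ℂ g U ∧ A ∩ U = U ∩ g ⁻¹' {0} ∧
        Surjective (fderiv ℂ g z) ∧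
        ∀ v : E₂, ∃ u : WithLp 2 (E₁ × E₂), fderiv ℂ g z u = 0 ∧ (ofLp u).2 = v}) = 0 := by
  classical
  set R : Set (WithLp 2 (E₁ × E₂)) := {z ∈ A | ∃ c, SCV.IsRegPt A c z} with hR
  set Crit : Set (WithLp 2 (E₁ × E₂)) := {z ∈ A | (∃ c, SCV.IsRegPt A c z) ∧
      ¬ ∃ (U : Set (WithLp 2 (E₁ × E₂))) (c : ℕ) (g : WithLp 2 (E₁ × E₂) → (Fin c → ℂ)),
        IsOpen U ∧ z ∈ U ∧ DifferentiableOn ℂ g U ∧ A ∩ U = U ∩ g ⁻¹' {0} ∧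
        Surjective (fderiv ℂ g z) ∧
        ∀ v : E₂, ∃ u : WithLp 2 (E₁ × E₂), fderiv ℂ g z u = 0 ∧ (ofLp u).2 = v} with hCrit
  -- local statement: every regular point has a neighbourhood whose critical points have null image
  have hloc : ∀ z₀ ∈ R, ∃ N : Set (WithLp 2 (E₁ × E₂)), IsOpen N ∧ z₀ ∈ N ∧
      μ ((fun z : WithLp 2 (E₁ × E₂) ↦ (ofLp z).2) '' (Crit ∩ N)) = 0 := by
    rintro z₀ ⟨hz₀A, c, hreg⟩
    obtain ⟨N, g, K, π, ρ, Ψ₀, hNo, hz₀N, -, hg, hgA, hsurj, hrank, hρ, hΨ, hΨ0, himage, hπ⟩ :=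
      hreg.exists_straightParam hz₀A univ_mem
    haveI : FiniteDimensional ℝ K := FiniteDimensional.complexToReal K
    set f : K → E₂ := fun k ↦ (ofLp (Ψ₀ k)).2 with hf
    -- `f` is smooth on the ball
    have hfs : ContDiffOn ℝ ∞ f (ball 0 ρ) := by
      have h1 : ContDiffOn ℝ ∞ Ψ₀ (ball 0 ρ) :=
        ((Literature.Analysis.Complex.SCV.analyticOnNhd_of_differentiableOn hΨ isOpen_ball).contDiffOn
          isOpen_ball.uniqueDiffOn).restrict_scalars ℝ
      have h2 : ContDiff ℝ ∞ (fun z : WithLp 2 (E₁ × E₂) ↦ (ofLp z).2) :=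
        ((ContinuousLinearMap.snd ℝ E₁ E₂).comp
          (WithLp.prodContinuousLinearEquiv 2 ℝ E₁ E₂ : WithLp 2 (E₁ × E₂) →L[ℝ] E₁ × E₂)).contDiff
      exact h2.comp_contDiffOn h1
    have hSard := Literature.Analysis.Calculus.measure_image_setOf_not_surjective_fderiv_eq_zero μ
      isOpen_ball hfs
    refine ⟨N, hNo, hz₀N, measure_mono_null ?_ hSard⟩
    rintro _ ⟨z, ⟨hzC, hzN⟩, rfl⟩
    have hzA : z ∈ A := hzC.1
    obtain ⟨k, hk, rfl⟩ : z ∈ Ψ₀ '' ball 0 ρ := himage ▸ ⟨hzA, hzN⟩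
    refine ⟨k, ⟨hk, fun hs ↦ hzC.2.2 ?_⟩, rfl⟩
    -- a surjective differential makes `Ψ₀ k` non-critical
    refine ⟨N, c, g, hNo, hzN, hg, ?_, hsurj _ hzN,
      forall_exists_mem_ker_of_surjective_fderiv_snd_straightParam hNo hg hgA hsurj hrank hΨ himage hπ
        hk hs⟩
    ext w
    exact ⟨fun h ↦ ⟨h.2, (hgA w h.2).1 h.1⟩, fun h ↦ ⟨(hgA w h.1).2 h.2, h.1⟩⟩
  choose! N hNo hzN hN0 using hloc
  obtain ⟨T, hTR, hTc, hcover⟩ := TopologicalSpace.countable_cover_nhdsWithin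
    (fun z (hz : z ∈ R) ↦ mem_nhdsWithin_of_mem_nhds ((hNo z hz).mem_nhds (hzN z hz)))
  have hsub : (fun z : WithLp 2 (E₁ × E₂) ↦ (ofLp z).2) '' Crit ⊆
      ⋃ z ∈ T, (fun z : WithLp 2 (E₁ × E₂) ↦ (ofLp z).2) '' (Crit ∩ N z) := by
    rintro _ ⟨z, hz, rfl⟩
    have hzR : z ∈ R := ⟨hz.1, hz.2.1⟩
    obtain ⟨z₀, hz₀, hzz₀⟩ := mem_iUnion₂.1 (hcover hzR)
    exact mem_iUnion₂.2 ⟨z₀, hz₀, ⟨z, ⟨hz, hzz₀⟩, rfl⟩⟩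
  refine measure_mono_null hsub ?_
  rw [measure_biUnion_null_iff hTc]
  exact fun z hz ↦ hN0 z (hTR hz)

end Sard

/-! ### §6 Almost every slice of a lower-dimensional analytic set is null -/

section GenericNull

variable [MeasurableSpace E₁] [BorelSpace E₁] [MeasurableSpace E₂] [BorelSpace E₂]

omit [MeasurableSpace E₂] [BorelSpace E₂] in
/-- **The slices of the regular part are null in the right dimension, off the critical values**: if
every regular point of `B ⊆ E₁ ⊞ E₂` has dimension `≤ m` and `m < k + dim E₂`, then for every `t`
which is not a critical value (§5) the slice of `reg B` over `t` is `𝓗^{2k}`-null (near each of its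
points the slice `B_t` is a submanifold of dimension `≤ m - dim E₂ < k`, §2).
[cite: Chirka1989, §2.3 and §3.7 Cor., p. 39] -/
theorem hausdorffMeasure_slice_regularLocus_eq_zero_of_notMem {B : Set (WithLp 2 (E₁ × E₂))} {m : ℕ}
    (hdim : ∀ z ∈ B, ∀ c, IsRegularPointOfCodim 𝓘(ℂ, WithLp 2 (E₁ × E₂)) B c z →
      finrank ℂ (WithLp 2 (E₁ × E₂)) ≤ c + m)
    {k : ℕ} (hk : m < k + finrank ℂ E₂) {t : E₂}
    (ht : t ∉ (fun z : WithLp 2 (E₁ × E₂) ↦ (ofLp z).2) '' {z ∈ B | (∃ c, SCV.IsRegPt B c z) ∧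
      ¬ ∃ (U : Set (WithLp 2 (E₁ × E₂))) (c : ℕ) (g : WithLp 2 (E₁ × E₂) → (Fin c → ℂ)),
        IsOpen U ∧ z ∈ U ∧ DifferentiableOn ℂ g U ∧ B ∩ U = U ∩ g ⁻¹' {0} ∧
        Surjective (fderiv ℂ g z) ∧
        ∀ v : E₂, ∃ u : WithLp 2 (E₁ × E₂), fderiv ℂ g z u = 0 ∧ (ofLp u).2 = v}) :
    μH[((2 * k : ℕ) : ℝ)] {x : E₁ | toLp 2 (x, t) ∈ regularLocus 𝓘(ℂ, WithLp 2 (E₁ × E₂)) B} = 0 := by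
  have hn : finrank ℂ (WithLp 2 (E₁ × E₂)) = finrank ℂ E₁ + finrank ℂ E₂ := by
    rw [(WithLp.linearEquiv 2 ℂ (E₁ × E₂)).finrank_eq, Module.finrank_prod]
  refine measure_null_of_locally_null _ fun x hx ↦ ?_
  obtain ⟨hzB, c, hc⟩ := hx
  have hreg : SCV.IsRegPt B c (toLp 2 (x, t)) := SCV.isRegularPointOfCodim_iff_isRegPt.1 hc
  -- `(x, t)` is non-critical since `t` is not a critical value
  have hnc : ∃ (U : Set (WithLp 2 (E₁ × E₂))) (c : ℕ) (g : WithLp 2 (E₁ × E₂) → (Fin c → ℂ)),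
      IsOpen U ∧ toLp 2 (x, t) ∈ U ∧ DifferentiableOn ℂ g U ∧ B ∩ U = U ∩ g ⁻¹' {0} ∧
      Surjective (fderiv ℂ g (toLp 2 (x, t))) ∧
      ∀ v : E₂, ∃ u : WithLp 2 (E₁ × E₂), fderiv ℂ g (toLp 2 (x, t)) u = 0 ∧ (ofLp u).2 = v := by
    by_contra hcon
    exact ht ⟨toLp 2 (x, t), ⟨hzB, ⟨c, hreg⟩, hcon⟩, rfl⟩
  obtain ⟨U, c', g, hU, hzU, hg, hBU, hsurj, hker⟩ := hnc
  have hx' : SCV.IsRegPt {x' : E₁ | toLp 2 (x', t) ∈ B} c' x :=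
    isRegPt_slice_of_nonCritical hzB hU hzU hg hBU hsurj hker hU hzU hg hBU hsurj
  have hc'n : c' ≤ finrank ℂ E₁ := (SCV.isRegularPointOfCodim_iff_isRegPt.2 hx').le_finrank
  have hcod : finrank ℂ (WithLp 2 (E₁ × E₂)) ≤ c' + m :=
    hdim _ hzB c' (SCV.isRegularPointOfCodim_iff_isRegPt.2 ⟨U, hU, hzU, g, hg, hBU, hsurj⟩)
  have hlt : 2 * (finrank ℂ E₁ - c') < 2 * k := by omega
  obtain ⟨Nx, hNx, hNx0⟩ := hx'.exists_nhds_hausdorffMeasure_inter_eq_zero hzB hlt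
  refine ⟨Nx ∩ {x' : E₁ | toLp 2 (x', t) ∈ regularLocus 𝓘(ℂ, WithLp 2 (E₁ × E₂)) B},
    inter_mem (mem_nhdsWithin_of_mem_nhds hNx) self_mem_nhdsWithin, measure_mono_null ?_ hNx0⟩
  rintro y ⟨hyN, hyB, -⟩
  exact ⟨hyB, hyN⟩

omit [MeasurableSpace E₁] [BorelSpace E₁] [MeasurableSpace E₂] [BorelSpace E₂] in
/-- An analytic set all of whose regular points have dimension `0` (codimension `≥ dim E`) has empty
singular locus: the singular locus is analytic ([Chirka1989, §4.5], the tree's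
`isAnalyticSet_singularLocus_holds`) of codimension `> dim E` at its regular points, which are dense in
it ([Chirka1989, §2.3 Thm.]). [cite: Chirka1989, §2.3 Theorem and §4.5] -/
theorem singularLocus_eq_empty_of_finrank_le_codim {B : Set (WithLp 2 (E₁ × E₂))}
    (hB : IsAnalyticSet 𝓘(ℂ, WithLp 2 (E₁ × E₂)) B)
    (hdim : ∀ z ∈ B, ∀ c, IsRegularPointOfCodim 𝓘(ℂ, WithLp 2 (E₁ × E₂)) B c z →
      finrank ℂ (WithLp 2 (E₁ × E₂)) ≤ c) :
    singularLocus 𝓘(ℂ, WithLp 2 (E₁ × E₂)) B = ∅ := by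
  have hS := isAnalyticSet_singularLocus_holds 𝓘(ℂ, WithLp 2 (E₁ × E₂)) (WithLp 2 (E₁ × E₂)) hB
  by_contra hne
  obtain ⟨y, hy⟩ := Set.nonempty_iff_ne_empty.2 hne
  have hcl := IsAnalyticSet.subset_closure_regularLocus_holds 𝓘(ℂ, WithLp 2 (E₁ × E₂))
    (WithLp 2 (E₁ × E₂)) hS hy
  obtain ⟨w, ⟨hwS, c, hc⟩⟩ : (regularLocus 𝓘(ℂ, WithLp 2 (E₁ × E₂))
      (singularLocus 𝓘(ℂ, WithLp 2 (E₁ × E₂)) B)).Nonempty := by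
    by_contra h0
    rw [Set.not_nonempty_iff_eq_empty] at h0
    rw [h0, closure_empty] at hcl
    exact hcl
  have h1 := hB.succ_le_codim_singularLocus (c₀ := finrank ℂ (WithLp 2 (E₁ × E₂)))
    (fun z c hz h ↦ hdim z hz c h) hwS hc
  have h2 := hc.le_finrank
  omega

/-- **Almost every slice of an analytic set of dimension `≤ m` is `𝓗^{2k}`-null for `m < k + dim E₂`**
(generic slices drop the dimension by `dim E₂`; Federer's coarea/Eilenberg inequality in the analytic
category, proved here by Sard on the regular strata and induction on the dimension through the
singular locus, [Chirka1989, §2.3, §3.7 Cor.; Cartan–Whitney §4.5 / the tree's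
`isAnalyticSet_singularLocus_holds`]). [cite: Chirka1989, §3.7 Cor., p. 39] [cite: Federer1969, 2.10.25 and 3.2.22] -/
theorem ae_hausdorffMeasure_slice_eq_zero_of_dim_le (μ : Measure E₂) [μ.IsAddHaarMeasure] (m : ℕ) :
    ∀ {B : Set (WithLp 2 (E₁ × E₂))}, IsAnalyticSet 𝓘(ℂ, WithLp 2 (E₁ × E₂)) B →
      (∀ z ∈ B, ∀ c, IsRegularPointOfCodim 𝓘(ℂ, WithLp 2 (E₁ × E₂)) B c z →
        finrank ℂ (WithLp 2 (E₁ × E₂)) ≤ c + m) →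
      ∀ {k : ℕ}, m < k + finrank ℂ E₂ →
        ∀ᵐ t ∂μ, μH[((2 * k : ℕ) : ℝ)] {x : E₁ | toLp 2 (x, t) ∈ B} = 0 := by
  induction m with
  | zero =>
    intro B hB hdim k hk
    have hsing : singularLocus 𝓘(ℂ, WithLp 2 (E₁ × E₂)) B = ∅ :=
      singularLocus_eq_empty_of_finrank_le_codim hB (fun z hz c h ↦ by have := hdim z hz c h; omega)
    filter_upwards [measure_eq_zero_iff_ae_notMem.1 (measure_image_snd_critical_eq_zero μ B)] with t ht
    have hBeq : B = regularLocus 𝓘(ℂ, WithLp 2 (E₁ × E₂)) B := by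
      conv_lhs => rw [← regularLocus_union_singularLocus (I := 𝓘(ℂ, WithLp 2 (E₁ × E₂))) B, hsing,
        union_empty]
    rw [hBeq]
    exact hausdorffMeasure_slice_regularLocus_eq_zero_of_notMem (fun z hz c h ↦ hdim z hz c (hBeq ▸ h)) hk ht
  | succ m ih =>
    intro B hB hdim k hk
    have hS := isAnalyticSet_singularLocus_holds 𝓘(ℂ, WithLp 2 (E₁ × E₂)) (WithLp 2 (E₁ × E₂)) hB
    have hdimS : ∀ z ∈ singularLocus 𝓘(ℂ, WithLp 2 (E₁ × E₂)) B, ∀ c,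
        IsRegularPointOfCodim 𝓘(ℂ, WithLp 2 (E₁ × E₂)) (singularLocus 𝓘(ℂ, WithLp 2 (E₁ × E₂)) B) c z →
          finrank ℂ (WithLp 2 (E₁ × E₂)) ≤ c + m := by
      intro z hz c hc
      have := hB.succ_le_codim_singularLocus (c₀ := finrank ℂ (WithLp 2 (E₁ × E₂)) - (m + 1))
        (fun w c' hw h ↦ by have := hdim w hw c' h; omega) hz hc
      omega
    have hk' : m < k + finrank ℂ E₂ := by omega
    filter_upwards [measure_eq_zero_iff_ae_notMem.1 (measure_image_snd_critical_eq_zero μ B),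
      ih hS hdimS hk'] with t ht hsing
    have hsub : {x : E₁ | toLp 2 (x, t) ∈ B} ⊆
        {x : E₁ | toLp 2 (x, t) ∈ regularLocus 𝓘(ℂ, WithLp 2 (E₁ × E₂)) B} ∪
          {x : E₁ | toLp 2 (x, t) ∈ singularLocus 𝓘(ℂ, WithLp 2 (E₁ × E₂)) B} := by
      intro x hx
      rcases (regularLocus_union_singularLocus (I := 𝓘(ℂ, WithLp 2 (E₁ × E₂))) B).symm.subset hx with h | h
      · exact Or.inl h
      · exact Or.inr h
    exact measure_mono_null hsub (measure_union_null
      (hausdorffMeasure_slice_regularLocus_eq_zero_of_notMem hdim hk ht) hsing)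

/-! ### §7 Almost every slice of a pure-dimensional analytic set is pure-dimensional -/

omit [MeasurableSpace E₂] [BorelSpace E₂] in
/-- **Purity of a slice off the critical values and off the bad slices of the singular locus.** Let
`A ⊆ E₁ ⊞ E₂` have pure dimension `D = q + dim E₂` and let `t ∈ E₂` be such that (i) `t` is not a
critical value of `pr₂` on `reg A` (§5) and (ii) the slice of `sng A` over `t` is `𝓗^{2q}`-null (§6). If
the slice `A_t` is non-empty, it has pure dimension `q`: its regular points have dimension `≥ q` by §4,
and a regular point of dimension `r > q` would carry positive `𝓗^{2r}`-mass (§3) on a neighbourhood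
meeting `A_t` only in points of `(sng A)_t` — the points of `(reg A)_t` being regular of dimension
exactly `q` (§2) — a `𝓗^{2r}`-null set. [cite: Chirka1989, §3.5 Prop. 2 (p. 36) and §2.3 (p. 29)]
[cite: Federer1969, 3.2.22] -/
theorem hasPureDim_slice_of_notMem_of_null {A : Set (WithLp 2 (E₁ × E₂))} {D q : ℕ}
    (hA : HasPureDim 𝓘(ℂ, WithLp 2 (E₁ × E₂)) A D) (hD : D = q + finrank ℂ E₂) {t : E₂}
    (ht : t ∉ (fun z : WithLp 2 (E₁ × E₂) ↦ (ofLp z).2) '' {z ∈ A | (∃ c, SCV.IsRegPt A c z) ∧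
      ¬ ∃ (U : Set (WithLp 2 (E₁ × E₂))) (c : ℕ) (g : WithLp 2 (E₁ × E₂) → (Fin c → ℂ)),
        IsOpen U ∧ z ∈ U ∧ DifferentiableOn ℂ g U ∧ A ∩ U = U ∩ g ⁻¹' {0} ∧
        Surjective (fderiv ℂ g z) ∧
        ∀ v : E₂, ∃ u : WithLp 2 (E₁ × E₂), fderiv ℂ g z u = 0 ∧ (ofLp u).2 = v})
    (hnull : μH[((2 * q : ℕ) : ℝ)]
      {x : E₁ | toLp 2 (x, t) ∈ singularLocus 𝓘(ℂ, WithLp 2 (E₁ × E₂)) A} = 0)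
    (hne : {x : E₁ | toLp 2 (x, t) ∈ A}.Nonempty) :
    HasPureDim 𝓘(ℂ, E₁) {x : E₁ | toLp 2 (x, t) ∈ A} q := by
  have hn : finrank ℂ (WithLp 2 (E₁ × E₂)) = finrank ℂ E₁ + finrank ℂ E₂ := by
    rw [(WithLp.linearEquiv 2 ℂ (E₁ × E₂)).finrank_eq, Module.finrank_prod]
  obtain ⟨c₀, hDc₀, hAa, -, hAreg⟩ := id hA
  refine ⟨finrank ℂ E₁ - q, by omega, isAnalyticSet_slice hAa t, hne, fun x hx ↦ ?_⟩
  obtain ⟨hxA, c', hc'⟩ := hx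
  have hxA' : toLp 2 (x, t) ∈ A := hxA
  have hreg : SCV.IsRegPt {x' : E₁ | toLp 2 (x', t) ∈ A} c' x := SCV.isRegularPointOfCodim_iff_isRegPt.1 hc'
  have hlow : c' + D ≤ finrank ℂ E₁ + finrank ℂ E₂ := add_le_finrank_of_isRegPt_slice hA hxA' hreg
  suffices hc'eq : c' = finrank ℂ E₁ - q by rw [← hc'eq]; exact hc'
  by_contra hne'
  have hlt : c' < finrank ℂ E₁ - q := by omega
  -- a neighbourhood of `x` in which every point of the slice is regular of codimension `c'`
  obtain ⟨N, g, K, π, ρ, Ψ₀, hNo, hxN, -, hg, hgS, hsurjN, -, -, -, -, -, -⟩ :=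
    hreg.exists_straightParam hxA' univ_mem
  -- near `x`, the slice only meets `(sng A)_t`
  have hsub : {x' : E₁ | toLp 2 (x', t) ∈ A} ∩ N ⊆
      {x' : E₁ | toLp 2 (x', t) ∈ singularLocus 𝓘(ℂ, WithLp 2 (E₁ × E₂)) A} := by
    rintro y ⟨hyA, hyN⟩
    refine ⟨hyA, fun hyreg ↦ ?_⟩
    obtain ⟨-, c, hc⟩ := hyreg
    have hregE : SCV.IsRegPt A c (toLp 2 (y, t)) := SCV.isRegularPointOfCodim_iff_isRegPt.1 hc
    have hnc : ∃ (U : Set (WithLp 2 (E₁ × E₂))) (c : ℕ) (g : WithLp 2 (E₁ × E₂) → (Fin c → ℂ)),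
        IsOpen U ∧ toLp 2 (y, t) ∈ U ∧ DifferentiableOn ℂ g U ∧ A ∩ U = U ∩ g ⁻¹' {0} ∧
        Surjective (fderiv ℂ g (toLp 2 (y, t))) ∧
        ∀ v : E₂, ∃ u : WithLp 2 (E₁ × E₂), fderiv ℂ g (toLp 2 (y, t)) u = 0 ∧ (ofLp u).2 = v := by
      by_contra hcon
      exact ht ⟨toLp 2 (y, t), ⟨hyA, ⟨c, hregE⟩, hcon⟩, rfl⟩
    obtain ⟨U, c₁, g₁, hU, hzU, hg₁, hAU, hsurj₁, hker⟩ := hnc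
    have hy₁ : SCV.IsRegPt {x' : E₁ | toLp 2 (x', t) ∈ A} c₁ y :=
      isRegPt_slice_of_nonCritical hyA hU hzU hg₁ hAU hsurj₁ hker hU hzU hg₁ hAU hsurj₁
    have hc₁reg : IsRegularPointOfCodim 𝓘(ℂ, WithLp 2 (E₁ × E₂)) A c₁ (toLp 2 (y, t)) :=
      SCV.isRegularPointOfCodim_iff_isRegPt.2 ⟨U, hU, hzU, g₁, hg₁, hAU, hsurj₁⟩
    have hc₀reg := hAreg _ ⟨hyA, c₁, hc₁reg⟩
    have hc₁₀ : c₁ = c₀ := hc₁reg.codim_unique (Z := A) hyA hc₀reg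
    have hy' : SCV.IsRegPt {x' : E₁ | toLp 2 (x', t) ∈ A} c' y := by
      refine ⟨N, hNo, hyN, g, hg, ?_, hsurjN y hyN⟩
      ext w
      exact ⟨fun h ↦ ⟨h.2, (hgS w h.2).1 h.1⟩, fun h ↦ ⟨(hgS w h.1).2 h.2, h.1⟩⟩
    have hc'c₁ : c' = c₁ := (SCV.isRegularPointOfCodim_iff_isRegPt.2 hy').codim_unique hyA
      (SCV.isRegularPointOfCodim_iff_isRegPt.2 hy₁)
    omega
  -- positivity of `𝓗^{2(dim E₁ - c')}` near `x` against nullity of `(sng A)_t`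
  have hpos := hreg.hausdorffMeasure_inter_pos hxA' (hNo.mem_nhds hxN)
  have hle : ((2 * q : ℕ) : ℝ) ≤ ((2 * (finrank ℂ E₁ - c') : ℕ) : ℝ) := by
    exact_mod_cast (show 2 * q ≤ 2 * (finrank ℂ E₁ - c') by omega)
  have h0 : μH[((2 * (finrank ℂ E₁ - c') : ℕ) : ℝ)] ({x' : E₁ | toLp 2 (x', t) ∈ A} ∩ N) = 0 :=
    measure_mono_null hsub (le_antisymm ((hausdorffMeasure_mono hle _).trans hnull.le) bot_le)
  exact absurd h0 hpos.ne'

/-- **Generic slices of a pure-dimensional analytic set** (the analytic case of [Federer1969, 3.2.22]):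
for `A ⊆ E₁ ⊞ E₂` of pure dimension `D = q + dim E₂` and almost every `t ∈ E₂` (any Haar measure):
(i) `t` is not a critical value of `pr₂` on `reg A` (§5, Sard), (ii) the slice of `sng A` over `t` is
`𝓗^{2q}`-null (§6), and consequently (iii) the slice `A_t = {x : (x, t) ∈ A}` is EMPTY OR AN ANALYTIC
SUBSET OF `E₁` OF PURE DIMENSION `q` (§7). [cite: Federer1969, 3.2.22] [cite: Chirka1989, §3.5 Prop. 2, §3.7 Cor.] -/
theorem ae_hasPureDim_slice (μ : Measure E₂) [μ.IsAddHaarMeasure] {A : Set (WithLp 2 (E₁ × E₂))} {D q : ℕ}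
    (hA : HasPureDim 𝓘(ℂ, WithLp 2 (E₁ × E₂)) A D) (hD : D = q + finrank ℂ E₂) :
    ∀ᵐ t ∂μ,
      t ∉ (fun z : WithLp 2 (E₁ × E₂) ↦ (ofLp z).2) '' {z ∈ A | (∃ c, SCV.IsRegPt A c z) ∧
        ¬ ∃ (U : Set (WithLp 2 (E₁ × E₂))) (c : ℕ) (g : WithLp 2 (E₁ × E₂) → (Fin c → ℂ)),
          IsOpen U ∧ z ∈ U ∧ DifferentiableOn ℂ g U ∧ A ∩ U = U ∩ g ⁻¹' {0} ∧
          Surjective (fderiv ℂ g z) ∧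
          ∀ v : E₂, ∃ u : WithLp 2 (E₁ × E₂), fderiv ℂ g z u = 0 ∧ (ofLp u).2 = v} ∧
      μH[((2 * q : ℕ) : ℝ)] {x : E₁ | toLp 2 (x, t) ∈ singularLocus 𝓘(ℂ, WithLp 2 (E₁ × E₂)) A} = 0 ∧
      ({x : E₁ | toLp 2 (x, t) ∈ A} = ∅ ∨ HasPureDim 𝓘(ℂ, E₁) {x : E₁ | toLp 2 (x, t) ∈ A} q) := by
  have hn : finrank ℂ (WithLp 2 (E₁ × E₂)) = finrank ℂ E₁ + finrank ℂ E₂ := by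
    rw [(WithLp.linearEquiv 2 ℂ (E₁ × E₂)).finrank_eq, Module.finrank_prod]
  obtain ⟨c₀, hDc₀, hAa, -, hAreg⟩ := id hA
  have hS := isAnalyticSet_singularLocus_holds 𝓘(ℂ, WithLp 2 (E₁ × E₂)) (WithLp 2 (E₁ × E₂)) hAa
  -- the singular locus has dimension `≤ D - 1`
  have hcod : ∀ z c, z ∈ A → IsRegularPointOfCodim 𝓘(ℂ, WithLp 2 (E₁ × E₂)) A c z → c₀ ≤ c :=
    fun z c hz h ↦ ((hAreg z ⟨hz, c, h⟩).codim_unique hz h).le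
  have hdimS : ∀ z ∈ singularLocus 𝓘(ℂ, WithLp 2 (E₁ × E₂)) A, ∀ c,
      IsRegularPointOfCodim 𝓘(ℂ, WithLp 2 (E₁ × E₂)) (singularLocus 𝓘(ℂ, WithLp 2 (E₁ × E₂)) A) c z →
        finrank ℂ (WithLp 2 (E₁ × E₂)) ≤ c + (D - 1) := by
    intro z hz c hc
    have h1 := hAa.succ_le_codim_singularLocus hcod hz hc
    have h2 := hc.le_finrank
    omega
  -- the null-slice statement for `sng A` (trivial when `D = 0`, where `sng A = ∅`)
  have hnull : ∀ᵐ t ∂μ, μH[((2 * q : ℕ) : ℝ)]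
      {x : E₁ | toLp 2 (x, t) ∈ singularLocus 𝓘(ℂ, WithLp 2 (E₁ × E₂)) A} = 0 := by
    rcases Nat.eq_zero_or_pos D with hD0 | hD0
    · have hsing : singularLocus 𝓘(ℂ, WithLp 2 (E₁ × E₂)) A = ∅ :=
        singularLocus_eq_empty_of_finrank_le_codim hAa (fun z hz c h ↦ by have := hcod z c hz h; omega)
      refine Eventually.of_forall fun t ↦ ?_
      simp only [hsing, mem_empty_iff_false, setOf_false, measure_empty]
    · exact ae_hausdorffMeasure_slice_eq_zero_of_dim_le μ (D - 1) hS hdimS (k := q) (by omega)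
  filter_upwards [measure_eq_zero_iff_ae_notMem.1 (measure_image_snd_critical_eq_zero μ A), hnull]
    with t ht hnt
  refine ⟨ht, hnt, ?_⟩
  rcases Set.eq_empty_or_nonempty {x : E₁ | toLp 2 (x, t) ∈ A} with h | h
  · exact Or.inl h
  · exact Or.inr (hasPureDim_slice_of_notMem_of_null hA hD ht hnt h)

end GenericNull

end Literature.Geometry.Kaehler

end
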